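import Literature.NumberTheory.DiophantineGeometry.GenEllMell
import Literature.NumberTheory.DiophantineGeometry.GenEllNorthcott
import Literature.AlgebraicGeometry.PlaneCurves.LegendreFormClassification
import Mathlib.Analysis.SpecialFunctions.Pow.Real
import Mathlib.Analysis.Complex.Polynomial.Basic
import Mathlib.FieldTheory.IsAlgClosed.Basic
import HarnessLib

/-!
# [GenEll] Remarks 4.4.1 and 4.4.2: the size of `log(l)` for the primes of Corollaries 4.3/4.4, and
# the `λ`-line (Legendre) version of Corollary 4.4

S. Mochizuki, *Arithmetic elliptic curves in general position*, Math. J. Okayama Univ. **52** (2010)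
[cite: MochizukiGenEll2010] (kurims manuscript, read on the page: Cor. 4.4 p. 23, Rmk. 4.4.1 and
Rmk. 4.4.2 p. 24). Classical and undisputed; additive over the landed [GenEll] vocabulary of
`GenEllProjLine` (`NFPoint`, `U_P`, `CBData`) and `GenEllMell` (`EllPoint`, `htFalt`), and over the
tree's Legendre-form files (`LegendreFormGoodModelProofs.legendre_isElliptic_iff`,
`LegendreFormClassification.legendre_j`, `legendre_j_eq_iff`) — reused, not re-proved.

## Rmk. 4.4.1 (p. 24), CLAIM-FORM and PROVED

> Typically, in computations of arithmetic degrees, such as heights [i.e., "`ht_Falt(−)`", etc.], the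
> terms that appear in a sum that computes the arithmetic degree are not terms that are "polynomial in
> `l`", but rather terms that are linear in `log(l)`. Thus, in the context of Corollaries 4.3, 4.4, if `l`
> is equal to `l◦` or `l•`, then `log(l)` is of the order of `log(ht_Falt(−)) + (1+ε)log(d)` or
> `log(ht_Falt(−)) + log(log-diff_{M_ell}(−)) + (1+ε)log(d)` — hence asymptotically bounded by
> `ε·(ht_Falt(−) + d)` or `ε·(ht_Falt(−) + log-diff_{M_ell}(−) + d)` — for `ε > 0`.

The printed bounds are `l◦ ≤ 23040·900d·ht_Falt + 2x_S + C·d^{1+ε}`,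
`l• ≤ 23040·900d·ht_Falt + 6d·log-diff + 2x_S + C·d^{1+ε}` (Cor. 4.3 (c), p. 22) and
`l◦ ≤ 23040·100d·ht_Falt + 2x_S + C·d`, `l• ≤ 23040·100d·ht_Falt + 6d·log-diff + 2x_S + C·d`
(Cor. 4.4 (c), p. 23). We type and prove the elementary
content, for an abstract bound of that shape `l ≤ A·d·h + 2x + C·d^κ` (`A, C, h, x ≥ 0`, `d ≥ 1`,
`κ ≥ 1`: Cor. 4.3 (c) p. 22 has `C·d^{1+ε}`, Cor. 4.4 (c) p. 23 has `C·d`):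
`log(l) ≤ log(h + 1) + κ·log(d) + log(A + 2x + C + 1)` (`Remark441.log_le_of_le_bound` — "of the
order of `log(ht) + (1+ε)log(d)`"; the `l•` case with the extra linear term `6d·log-diff` is
`log_le_eps_mul_of_le_bound'`), and, for every `ε > 0`, a constant `C_{ε,κ}` with
`log(h + 1) + κ·log(d) ≤ ε·(h + d) + C_{ε,κ}` for all `h ≥ 0`, `d ≥ 1`
(`Remark441.log_add_log_le_eps_mul`), whence `log(l) ≤ ε·(h + d) + C_{ε,κ} + log(A + 2x + C + 1)`
(`Remark441.log_le_eps_mul_of_le_bound` — "asymptotically bounded by `ε·(ht + d)`"; the dependence on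
the excluded prime set `S` through `x = x_S` is kept explicit, as on the page).

## Rmk. 4.4.2 (p. 24): the `λ`-line version of Cor. 4.4

> Let `U_P ⊆ P` be as in Theorem 2.1, (ii). Thus, by regarding `U_P` as the "`λ`-line" [i.e.,
> regarding the standard coordinate on `P` as the "`λ`" in the Legendre form "`y² = x(x−1)(x−λ)`" of
> the Weierstrass equation defining an elliptic curve], one obtains a natural finite étale
> [classifying] morphism `U_P → M_ell ×_ℤ ℚ`. Then one verifies immediately that [relative to the
> elliptic curves obtained from points `∈ U_P(Q̄)` via this classifying morphism] one obtains a result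
> entirely similar to Corollary 4.4 by replacing "`M_ell ⊆ M̄_ell`" by `U_P ⊆ P`. In particular, in
> the context of Theorem 2.1, (ii), one may always assume the existence of prime numbers `l◦, l•` as in
> [this `U_P ⊆ P` version of] Corollary 4.4.

Typed here: the CLASSIFYING MAP on presented points, `NFPoint.legendre : (Q : NFPoint) → Q.InU →
EllPoint` (`λ ↦ E_λ : y² = x(x−1)(x−λ)` over the SAME presenting field `F`, elliptic exactly because
`λ ∉ {0,1}` — `legendre_isElliptic_iff`), with `(Q.legendre h).degree = Q.degree` (so the "`d`" of the
`U_P`-version is `[F_min(λ) : ℚ]`, as printed), its `j`-invariant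
`j(λ) = 2⁸(λ²−λ+1)³/(λ²(λ−1)²)` (`NFPoint.legendre_j`), and the finiteness of the fibres of
`λ ↦ j(λ)` inside one field (`NFPoint.mem_anharmonicSet_of_j_eq` / `legendre_fibre_finite`: the fibre
through `λ` lies in the six-element set `λ, λ⁻¹, 1−λ, (1−λ)⁻¹, λ/(λ−1), (λ−1)/λ` — the "finite" of
"finite étale"), and the transport of GALOIS-FINITE sets (`NFPoint.isGaloisFinite_legendre_preimage`: the
preimage of a Galois-finite `Exc ⊆ M_ell(Q̄)` — finitely many points in each degree, counted through
minimal polynomials — is Galois-finite in `U_P(Q̄)`; proof through an embedding into `ℂ` and the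
finitely many complex roots of `2⁸(X²−X+1)³ − j·X²(X−1)²` over the finitely many conjugates `j`).
The Cor-4.4-shaped
SENTENCE of the remark (conditions (a)(b)(c) for `E_λ` over `F_min(λ)`, `[λ]` in a compactly bounded
subset of `U_P`, outside a Galois-finite exceptional set) is NOT restated here: Cor. 4.4 itself is typed
by the [GenEll] §4 typer (abc-iut-S4, `GenEllPrimesPrescribed`, not yet in the tree) and the remark's
sentence is ONE definition over that vocabulary applied to `Q.legendre` — TODO-merge: abc-iut-S4.
Nothing here takes a side on anything disputed; everything below is proved.
-/

noncomputable section

open Real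

namespace Literature.NumberTheory.DiophantineGeometry.GenEll

/-! ## Rmk. 4.4.1 — `log(l)` versus the linear bound on `l` -/

namespace Remark441

/-- The shape of the Cor. 4.3/4.4 (c) bounds: if `1 ≤ l ≤ A·d·h + 2x + C·d^κ` with `A, C, h, x ≥ 0`, `d ≥ 1`
and an exponent `κ ≥ 1` (`κ = 1 + ε` in Cor. 4.3 (c), `κ = 1` in Cor. 4.4 (c)), then
`log l ≤ log(h+1) + κ·log d + log(A + 2x + C + 1)` — "`log(l)` is of the order of
`log(ht_Falt(−)) + (1+ε)log(d)`". [cite: MochizukiGenEll2010, Rmk 4.4.1 p.24] -/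
theorem log_le_of_le_bound {A C h x l κ : ℝ} {d : ℕ} (hA : 0 ≤ A) (hC : 0 ≤ C) (hh : 0 ≤ h)
    (hx : 0 ≤ x) (hd : 1 ≤ d) (hκ : 1 ≤ κ) (hl1 : 1 ≤ l)
    (hl : l ≤ A * d * h + 2 * x + C * (d : ℝ) ^ κ) :
    Real.log l ≤ Real.log (h + 1) + κ * Real.log d + Real.log (A + 2 * x + C + 1) := by
  have hd' : (1 : ℝ) ≤ d := by exact_mod_cast hd
  have hd0 : (0 : ℝ) < d := by linarith
  have hK : 0 < A + 2 * x + C + 1 := by positivity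
  -- `d ≤ d^κ`
  have hdk : (d : ℝ) ≤ (d : ℝ) ^ κ := by
    simpa using Real.rpow_le_rpow_of_exponent_le hd' hκ
  have hdk0 : (0 : ℝ) ≤ (d : ℝ) ^ κ := by positivity
  -- `l ≤ (h + 1) · d^κ · (A + 2x + C + 1)`
  have hbound : l ≤ (h + 1) * (d : ℝ) ^ κ * (A + 2 * x + C + 1) := by
    have h1 : A * d * h ≤ A * (d : ℝ) ^ κ * (h + 1) := by
      have : A * d ≤ A * (d : ℝ) ^ κ := mul_le_mul_of_nonneg_left hdk hA
      have : (0 : ℝ) ≤ A * (d : ℝ) ^ κ := by positivity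
      nlinarith
    have h2 : 2 * x ≤ 2 * x * (d : ℝ) ^ κ * (h + 1) := by
      have : (1 : ℝ) ≤ (d : ℝ) ^ κ * (h + 1) := by nlinarith
      nlinarith
    have h3 : C * (d : ℝ) ^ κ ≤ C * (d : ℝ) ^ κ * (h + 1) := by
      have : (0 : ℝ) ≤ C * (d : ℝ) ^ κ := by positivity
      nlinarith
    nlinarith
  calc Real.log l ≤ Real.log ((h + 1) * (d : ℝ) ^ κ * (A + 2 * x + C + 1)) :=
        Real.log_le_log (by linarith) hbound
    _ = Real.log (h + 1) + κ * Real.log d + Real.log (A + 2 * x + C + 1) := by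
        rw [Real.log_mul (by positivity) hK.ne', Real.log_mul (by positivity) (by positivity),
          Real.log_rpow hd0]

/-- `log t ≤ ε·t − (1 + log ε)` for `t, ε > 0` (from `log u ≤ u − 1` at `u = ε t`).
[cite: MochizukiGenEll2010, Rmk 4.4.1 p.24] -/
theorem log_le_eps_mul_sub {ε t : ℝ} (hε : 0 < ε) (ht : 0 < t) :
    Real.log t ≤ ε * t - (1 + Real.log ε) := by
  have h := Real.log_le_sub_one_of_pos (mul_pos hε ht)
  rw [Real.log_mul hε.ne' ht.ne'] at h
  linarith

/-- "hence asymptotically bounded by `ε·(ht_Falt(−) + d)`": for every `ε > 0` and exponent `κ > 0` there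
is a constant `C_{ε,κ}` with `log(h+1) + κ·log(d) ≤ ε·(h + d) + C_{ε,κ}` for all `h ≥ 0`, `d ≥ 1`.
[cite: MochizukiGenEll2010, Rmk 4.4.1 p.24] -/
theorem log_add_log_le_eps_mul {ε κ : ℝ} (hε : 0 < ε) (hκ : 0 < κ) :
    ∃ Cε : ℝ, ∀ (h : ℝ) (d : ℕ), 0 ≤ h → 1 ≤ d →
      Real.log (h + 1) + κ * Real.log d ≤ ε * (h + d) + Cε := by
  refine ⟨ε - (1 + Real.log ε) - κ * (1 + Real.log (ε / κ)), fun h d hh hd => ?_⟩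
  have hd' : (0 : ℝ) < d := by exact_mod_cast hd
  have h1 := log_le_eps_mul_sub hε (show 0 < h + 1 by linarith)
  have h2 := log_le_eps_mul_sub (div_pos hε hκ) hd'
  have h3 : κ * Real.log d ≤ κ * (ε / κ * d - (1 + Real.log (ε / κ))) :=
    mul_le_mul_of_nonneg_left h2 hκ.le
  have h4 : κ * (ε / κ * d) = ε * d := by field_simp
  nlinarith

/-- Rmk. 4.4.1 assembled: under a Cor-4.3/4.4-(c)-shaped bound `1 ≤ l ≤ A·d·h + 2x + C·d^κ` (`κ ≥ 1`),
for every `ε > 0`, `log l ≤ ε·(h + d) + C_{ε,κ} + log(A + 2x + C + 1)` with `C_{ε,κ}` depending only on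
`ε, κ`. [cite: MochizukiGenEll2010, Rmk 4.4.1 p.24] -/
theorem log_le_eps_mul_of_le_bound {ε κ : ℝ} (hε : 0 < ε) (hκ : 1 ≤ κ) :
    ∃ Cε : ℝ, ∀ (A C h x l : ℝ) (d : ℕ), 0 ≤ A → 0 ≤ C → 0 ≤ h → 0 ≤ x → 1 ≤ d → 1 ≤ l →
      l ≤ A * d * h + 2 * x + C * (d : ℝ) ^ κ →
      Real.log l ≤ ε * (h + d) + Cε + Real.log (A + 2 * x + C + 1) := by
  obtain ⟨Cε, hCε⟩ := log_add_log_le_eps_mul hε (lt_of_lt_of_le one_pos hκ)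
  refine ⟨Cε, fun A C h x l d hA hC hh hx hd hl1 hl => ?_⟩
  have h1 := log_le_of_le_bound hA hC hh hx hd hκ hl1 hl
  have h2 := hCε h d hh hd
  linarith

/-- The `l•` variant with the extra linear term `6d·log-diff` of Cor. 4.3/4.4 (c):
`1 ≤ l ≤ A·d·h + B·d·δ + 2x + C·d^κ` (`δ = log-diff_{M_ell} ≥ 0`, `κ ≥ 1`) gives, for every `ε > 0`,
`log l ≤ ε·(h + δ + d) + C_{ε,κ} + log(A + B + 2x + C + 1)` — "asymptotically bounded by
`ε·(ht_Falt(−) + log-diff_{M_ell}(−) + d)`". [cite: MochizukiGenEll2010, Rmk 4.4.1 p.24] -/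
theorem log_le_eps_mul_of_le_bound' {ε κ : ℝ} (hε : 0 < ε) (hκ : 1 ≤ κ) :
    ∃ Cε : ℝ, ∀ (A B C h δ x l : ℝ) (d : ℕ), 0 ≤ A → 0 ≤ B → 0 ≤ C → 0 ≤ h → 0 ≤ δ → 0 ≤ x →
      1 ≤ d → 1 ≤ l → l ≤ A * d * h + B * d * δ + 2 * x + C * (d : ℝ) ^ κ →
      Real.log l ≤ ε * (h + δ + d) + Cε + Real.log (A + B + 2 * x + C + 1) := by
  obtain ⟨Cε, hCε⟩ := log_add_log_le_eps_mul hε (lt_of_lt_of_le one_pos hκ)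
  refine ⟨Cε, fun A B C h δ x l d hA hB hC hh hδ hx hd hl1 hl => ?_⟩
  have hd' : (1 : ℝ) ≤ d := by exact_mod_cast hd
  -- regroup: `A d h + B d δ ≤ (A + B) · d · (h + δ)`
  have hl' : l ≤ (A + B) * d * (h + δ) + 2 * x + C * (d : ℝ) ^ κ := by
    have : (0 : ℝ) ≤ A * d * δ + B * d * h := by positivity
    nlinarith
  have h1 := log_le_of_le_bound (add_nonneg hA hB) hC (add_nonneg hh hδ) hx hd hκ hl1 hl'
  have h2 := hCε (h + δ) d (add_nonneg hh hδ) hd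
  have : Real.log (A + B + 2 * x + C + 1) = Real.log ((A + B) + 2 * x + C + 1) := by ring_nf
  rw [this]
  linarith

end Remark441

/-! ## Rmk. 4.4.2 — the Legendre classifying map `U_P → M_ell` on presented points -/

namespace NFPoint

open Literature.NumberTheory.EllipticCurves Literature.AlgebraicGeometry.PlaneCurves

/-- The Legendre curve `E_λ : y² = x(x−1)(x−λ)` attached to the affine coordinate `λ = Q.x` of a
presented point of `P = ℙ¹`, as Mathlib's Weierstrass curve `⟨0, −(1+λ), 0, λ, 0⟩` (the literal used
throughout the tree's Legendre files). [cite: MochizukiGenEll2010, Rmk 4.4.2 p.24] -/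
abbrev legendreCurve (Q : NFPoint) : WeierstrassCurve Q.F := ⟨0, -(1 + Q.x), 0, Q.x, 0⟩

/-- `E_λ` is elliptic exactly for `λ ∈ U_P`, i.e. `λ ≠ 0, 1` (`legendre_isElliptic_iff`; `2 ≠ 0` in a
number field). [cite: MochizukiGenEll2010, Rmk 4.4.2 p.24] -/
theorem legendreCurve_isElliptic_iff (Q : NFPoint) : Q.legendreCurve.IsElliptic ↔ Q.InU :=
  legendre_isElliptic_iff (F := Q.F) two_ne_zero Q.x

/-- **The classifying map `U_P(Q̄) → M_ell(Q̄)` on presented points**: `(F, λ) ↦ (F, E_λ)` for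
`λ ∈ U_P(F) = F ∖ {0, 1}`, the curve presented over the same field `F`.
[cite: MochizukiGenEll2010, Rmk 4.4.2 p.24] -/
def legendre (Q : NFPoint) (hQ : Q.InU) : EllPoint :=
  @EllPoint.mk Q.F _ _ Q.legendreCurve (Q.legendreCurve_isElliptic_iff.2 hQ)

/-- The classifying map keeps the presenting field. [cite: MochizukiGenEll2010, Rmk 4.4.2 p.24] -/
theorem legendre_F (Q : NFPoint) (hQ : Q.InU) : (Q.legendre hQ).F = Q.F := rfl

/-- The classifying map keeps the Weierstrass model `E_λ`. [cite: MochizukiGenEll2010, Rmk 4.4.2 p.24] -/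
theorem legendre_W (Q : NFPoint) (hQ : Q.InU) : (Q.legendre hQ).W = Q.legendreCurve := rfl

/-- Hence the "`d = [L : ℚ]`" of the `U_P`-version of Cor. 4.4 is the degree of the presenting field
of `λ`. [cite: MochizukiGenEll2010, Rmk 4.4.2 p.24] -/
theorem legendre_degree (Q : NFPoint) (hQ : Q.InU) : (Q.legendre hQ).degree = Q.degree := rfl

/-- The `j`-invariant of the classifying map: `j(E_λ) = 2⁸(λ² − λ + 1)³/(λ²(λ − 1)²)` (the tree's
`legendre_j`, Silverman III.1.7 (b)). [cite: MochizukiGenEll2010, Rmk 4.4.2 p.24] -/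
theorem legendre_j (Q : NFPoint) (hQ : Q.InU) :
    @WeierstrassCurve.j Q.F _ (Q.legendre hQ).W (Q.legendre hQ).instElliptic =
      2 ^ 8 * (Q.x ^ 2 - Q.x + 1) ^ 3 / (Q.x ^ 2 * (Q.x - 1) ^ 2) :=
  @Literature.AlgebraicGeometry.PlaneCurves.legendre_j Q.F _ two_ne_zero Q.x
    (Q.legendreCurve_isElliptic_iff.2 hQ)

/-- The six values `M_λ = {λ, λ⁻¹, 1−λ, (1−λ)⁻¹, λ/(λ−1), (λ−1)/λ}` (Kunz's set; the orbit of `λ` under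
the anharmonic group). [cite: MochizukiGenEll2010, Rmk 4.4.2 p.24] -/
def anharmonicSet {F : Type} [Field F] (la : F) : Set F :=
  {la, la⁻¹, 1 - la, (1 - la)⁻¹, la / (la - 1), (la - 1) / la}

/-- `M_λ` is finite (at most six elements). [cite: MochizukiGenEll2010, Rmk 4.4.2 p.24] -/
theorem anharmonicSet_finite {F : Type} [Field F] (la : F) : (anharmonicSet la).Finite := by
  unfold anharmonicSet
  exact Set.toFinite _

/-- **Finiteness of the fibres of the classifying map** ("finite [étale]"): within one presenting
field `F`, two points `λ, μ ∈ U_P(F)` have Legendre curves with the same `j`-invariant only if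
`μ ∈ M_λ` (the tree's `legendre_j_eq_iff`, Kunz Thm. 10.12). [cite: MochizukiGenEll2010, Rmk 4.4.2 p.24] -/
theorem mem_anharmonicSet_of_j_eq {F : Type} [Field F] [NumberField F] {la mu : F}
    (hla : (NFPoint.mk F la).InU) (hmu : (NFPoint.mk F mu).InU)
    (hj : ((NFPoint.mk F la).legendre hla).W.j = ((NFPoint.mk F mu).legendre hmu).W.j) :
    mu ∈ anharmonicSet la := by
  have h := (@legendre_j_eq_iff F _ two_ne_zero la mu
    ((NFPoint.mk F la).legendreCurve_isElliptic_iff.2 hla)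
    ((NFPoint.mk F mu).legendreCurve_isElliptic_iff.2 hmu)).1 hj
  simp only [anharmonicSet, Set.mem_insert_iff, Set.mem_singleton_iff]
  tauto

/-- The fibre of `λ ↦ j(E_λ)` through `λ` inside `U_P(F)` is finite (contained in `M_λ`).
[cite: MochizukiGenEll2010, Rmk 4.4.2 p.24] -/
theorem legendre_fibre_finite {F : Type} [Field F] [NumberField F] {la : F}
    (hla : (NFPoint.mk F la).InU) :
    {mu : F | ∃ hmu : (NFPoint.mk F mu).InU,
      ((NFPoint.mk F mu).legendre hmu).W.j = ((NFPoint.mk F la).legendre hla).W.j}.Finite := by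
  refine (anharmonicSet_finite la).subset ?_
  rintro mu ⟨hmu, hj⟩
  exact mem_anharmonicSet_of_j_eq hla hmu hj.symm

/-- The classifying map sends `U_P(Q̄)^{≤ d}` into `M_ell(Q̄)^{≤ d}` (same presenting field).
[cite: MochizukiGenEll2010, Rmk 4.4.2 p.24] -/
theorem legendre_mem_mellLe {d : ℕ} {Q : NFPoint} (hQ : Q ∈ UPle d) :
    Q.legendre hQ.1.1 ∈ MellLe d := hQ.2

/-! ### Galois-finite exceptional sets pull back along the classifying map

Cor. 4.4's exceptional set `Exc ⊆ M_ell(Q̄)` is Galois-finite; its preimage in `U_P(Q̄)` under the classifying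
map is again Galois-finite (finitely many Galois orbits of `λ` over finitely many Galois orbits of `j`,
the classifying map being finite) — the bookkeeping behind "one verifies immediately … by replacing
`M_ell` by `U_P`". Finiteness of point sets is counted through minimal polynomials as in
`GenEllNorthcott` (`HasFinitelyManyPoints`, `IsGaloisFinite`) and `GenEllMell` (`MellHasFinitelyManyPoints`). -/

section GaloisFinite

open Polynomial

/-- For `j ∈ ℂ` the polynomial `2⁸(X² − X + 1)³ − j·X²(X − 1)²`, whose roots are the `λ` with `j(E_λ) = j`,
is nonzero (its value at `0` is `2⁸`). [cite: MochizukiGenEll2010, Rmk 4.4.2 p.24] -/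
theorem legendreJPoly_ne_zero (jc : ℂ) :
    (C ((2 : ℂ) ^ 8) * (X ^ 2 - X + 1) ^ 3 - C jc * (X ^ 2 * (X - 1) ^ 2) : ℂ[X]) ≠ 0 := by
  intro h
  have h0 := congrArg (Polynomial.eval 0) h
  simp only [eval_sub, eval_mul, eval_C, eval_pow, eval_add, eval_X, eval_one, eval_zero] at h0
  norm_num at h0

/-- **Galois-finiteness transports along the classifying map**: if a set `M` of presented points of
`M_ell` has finitely many points (finitely many minimal polynomials of `j`), then its preimage under
`λ ↦ E_λ` has finitely many points of `U_P` (finitely many minimal polynomials of `λ`): every such `λ`,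
embedded in `ℂ`, is a root of `2⁸(X²−X+1)³ − j·X²(X−1)²` for one of the finitely many complex roots `j`
of one of the finitely many minimal polynomials. [cite: MochizukiGenEll2010, Rmk 4.4.2 p.24] -/
theorem hasFinitelyManyPoints_legendre_preimage {M : Set EllPoint} (hM : MellHasFinitelyManyPoints M) :
    HasFinitelyManyPoints {Q : NFPoint | ∃ hQ : Q.InU, Q.legendre hQ ∈ M} := by
  classical
  -- the finitely many complex `λ` lying over the finitely many complex roots `j` of the polynomials of `M`
  have hT : (⋃ m ∈ (fun P : EllPoint => minpoly ℚ P.W.j) '' M, ⋃ jc ∈ m.rootSet ℂ,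
      (C ((2 : ℂ) ^ 8) * (X ^ 2 - X + 1) ^ 3 - C jc * (X ^ 2 * (X - 1) ^ 2)).rootSet ℂ).Finite :=
    Set.Finite.biUnion hM fun m _ =>
      Set.Finite.biUnion (m.rootSet_finite ℂ) fun jc _ => Polynomial.rootSet_finite _ _
  refine (hT.image fun x : ℂ => minpoly ℚ x).subset ?_
  rintro _ ⟨Q, ⟨hQ, hQM⟩, rfl⟩
  haveI hE : Q.legendreCurve.IsElliptic := Q.legendreCurve_isElliptic_iff.2 hQ
  -- an embedding of the presenting number field into `ℂ`
  let σ : Q.F →ₐ[ℚ] ℂ := IsAlgClosed.lift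
  refine ⟨σ Q.x, ?_, minpoly.algHom_eq σ σ.injective Q.x⟩
  have hint : IsIntegral ℚ Q.legendreCurve.j := Algebra.IsIntegral.isIntegral _
  refine Set.mem_iUnion₂.2 ⟨minpoly ℚ Q.legendreCurve.j, ⟨Q.legendre hQ, hQM, rfl⟩, ?_⟩
  refine Set.mem_iUnion₂.2 ⟨σ Q.legendreCurve.j, ?_, ?_⟩
  · rw [Polynomial.mem_rootSet]
    exact ⟨minpoly.ne_zero hint, by rw [Polynomial.aeval_algHom_apply, minpoly.aeval, map_zero]⟩
  · rw [Polynomial.mem_rootSet]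
    refine ⟨legendreJPoly_ne_zero _, ?_⟩
    have hj := congrArg σ (legendre_j_mul (F := Q.F) two_ne_zero Q.x)
    simp only [map_mul, map_pow, map_sub, map_add, map_one, map_ofNat] at hj
    simp only [Polynomial.coe_aeval_eq_eval, eval_sub, eval_mul, eval_C, eval_pow, eval_add, eval_X,
      eval_one]
    linear_combination -hj

/-- Degree by degree: if `M ∩ M_ell(Q̄)^{≤ d}` has finitely many points then so does the part of degree
`≤ d` of the preimage of `M` in `U_P(Q̄)` (the classifying map preserves the presenting field).
[cite: MochizukiGenEll2010, Rmk 4.4.2 p.24] -/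
theorem hasFinitelyManyPoints_legendre_preimage_le {M : Set EllPoint} {d : ℕ}
    (hM : MellHasFinitelyManyPoints (M ∩ MellLe d)) :
    HasFinitelyManyPoints ({Q : NFPoint | ∃ hQ : Q.InU, Q.legendre hQ ∈ M} ∩ UPle d) :=
  (hasFinitelyManyPoints_legendre_preimage hM).mono (by
    rintro Q ⟨⟨hQ, hQM⟩, hd⟩
    exact ⟨hQ, hQM, hd.2⟩)

/-- **A Galois-finite exceptional set `Exc ⊆ M_ell(Q̄)` pulls back to a Galois-finite subset of `U_P(Q̄)`**
(Galois-finite = finitely many points in each degree, [GenEll] Ex. 1.3 (i)).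
[cite: MochizukiGenEll2010, Rmk 4.4.2 p.24] -/
theorem isGaloisFinite_legendre_preimage {M : Set EllPoint}
    (hM : ∀ d : ℕ, MellHasFinitelyManyPoints (M ∩ MellLe d)) :
    IsGaloisFinite {Q : NFPoint | ∃ hQ : Q.InU, Q.legendre hQ ∈ M} :=
  fun d => hasFinitelyManyPoints_legendre_preimage_le (hM d)

end GaloisFinite

end NFPoint

end Literature.NumberTheory.DiophantineGeometry.GenEll

end
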